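import Literature.NumberTheory.NumberFields.SqrtGeneratorUnramified
import Literature.NumberTheory.NumberFields.AmbiguousClassNumberFormula
import HarnessLib

/-!
# Ramification in `L = K(√−1)` above `2`: if `K` has ONE prime `𝔭` above `2` with ODD `e(𝔭 | 2)`, then `𝔭` ramifies
# in `L`, `L` has ONE prime above `2`, and `𝔭` is the only finite prime of `K` ramified in `L`

Topic `NumberTheory/NumberFields`; namespace `Literature.NumberTheory.NumberFields`. Theorem-only file (no definition, no
named fact, no `sorry`), written by the prover seat `bsd-2adic-k4-w2` GEN 9 (cell `bsd-2adic`; «GENUS-BRIDGE» step 2 for the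
sextic carriers `ℚ(β, √−1)` of K4's additive census; closes nothing there).

Let `K ⊆ L` be number fields with `[L : K] = 2`, `L/K` Galois, and `x ∈ 𝓞_L` with `x² = −1`.

* `even_ramificationIdx_int_of_sq_eq_neg_one` — for every prime `𝔓` of `𝓞_L` above `2`, `e(𝔓 | 2ℤ)` is EVEN: `(1 + x)² = 2x` with
  `x` a unit, so `2𝓞_L = (1 + x)²𝓞_L` and the exponent of `𝔓` in `2𝓞_L` is twice its exponent in `(1 + x)𝓞_L`.
* `ramificationIdxIn_eq_two_of_odd_ramificationIdx` — if `𝔭` is a prime of `𝓞_K` above `2` with `e(𝔭 | 2ℤ)` ODD, then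
  `e(𝔭, L/K) = 2` (multiplicativity of `e` in the tower `ℤ ⊂ 𝓞_K ⊂ 𝓞_L`, Mathlib `Ideal.ramificationIdx_tower`, and `e ∣ [L:K] = 2`);
  `ncard_primesOver_eq_one_of_odd_ramificationIdx` — and exactly ONE prime of `𝓞_L` lies over `𝔭` (`efg = 2`).
* `ramificationIdxIn_eq_one_of_two_not_mem` — a prime `v ∌ 2` of `𝓞_K` is unramified in `L = K(x)` (the tree's different bound
  `isUnramifiedAt_of_sq_eq`: a ramified prime contains `4 · (−1)`).
* **`existsUnique_two_mem_of_sq_eq_neg_one`** — if `K` has EXACTLY ONE prime above `2` and its `e` over `2` is odd, then `L` has exactly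
  one prime above `2`; **`finprod_ramificationIdxIn_eq_two_of_sq_eq_neg_one`** — and `∏_𝔮 e_𝔮(L/K) = 2` (with `L = K(x)`).

These are the two arithmetic inputs of the parity transfer `AmbiguousClass.odd_classNumber_of_quadratic_of_nrRealPlaces_eq_one`
(`QuadraticExtensionOddClassNumberTransfer.lean`) and of Iwasawa's unique-prime lemma (Iwasawa 1956) at `p = 2` for `L = K(√−1)`:
e.g. `K = ℚ(β)` a cubic field in which `2` is inert (`e = 1`) or totally ramified (`e = 3`).

## References

* J. Neukirch, *Algebraic Number Theory* (1999), Ch. I §8 (8.2) (fundamental identity), Ch. III (2.6) (different and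
  ramification). [NeukirchANT1999]
* D. A. Marcus, *Number Fields*, 2nd ed. (2018), Ch. 4 (multiplicativity of `e`, `f` in towers). [Marcus2018]
-/

noncomputable section

open NumberField IsDedekindDomain Ideal UniqueFactorizationMonoid

namespace Literature.NumberTheory.NumberFields

variable {K L : Type} [Field K] [NumberField K] [Field L] [NumberField L] [Algebra K L]

/-! ### `e(𝔓 | 2)` is even for every prime of `K(√−1)`-type fields -/

/-- **`e(𝔓 | 2ℤ)` is even** for every prime `𝔓` of `𝓞_L` above `2` when `𝓞_L` contains a square root `x` of `−1`:
`2𝓞_L = ((1 + x)𝓞_L)²` (`(1 + x)² = 2x`, `x` a unit). [cite: NeukirchANT1999, Ch. I §8 Prop. (8.2) and its proof] -/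
theorem even_ramificationIdx_int_of_sq_eq_neg_one {x : 𝓞 L} (hx : x ^ 2 = -1) (P : Ideal (𝓞 L)) [P.IsPrime]
    [P.LiesOver (Ideal.span {(2 : ℤ)})] : Even (P.ramificationIdx ℤ) := by
  classical
  have hmap : (Ideal.span {(2 : ℤ)}).map (algebraMap ℤ (𝓞 L)) = (Ideal.span {1 + x}) ^ 2 := by
    rw [Ideal.map_span, Set.image_singleton, map_ofNat, Ideal.span_singleton_pow]
    have hux : IsUnit x := by
      refine isUnit_iff_exists_inv.mpr ⟨-x, ?_⟩
      linear_combination (-1 : 𝓞 L) * hx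
    have h2 : (1 + x) ^ 2 = 2 * x := by linear_combination hx
    rw [h2]
    exact (Ideal.span_singleton_mul_right_unit hux 2).symm
  have hne : (Ideal.span {(2 : ℤ)}).map (algebraMap ℤ (𝓞 L)) ≠ ⊥ := by
    rw [Ne, Ideal.map_eq_bot_iff_of_injective (algebraMap ℤ (𝓞 L)).injective_int, Ideal.span_singleton_eq_bot]
    norm_num
  have h1x : Ideal.span {1 + x} ≠ (⊥ : Ideal (𝓞 L)) := by
    intro h
    rw [h, ← Ideal.zero_eq_bot, zero_pow two_ne_zero, Ideal.zero_eq_bot] at hmap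
    exact hne hmap
  rw [Ideal.IsDedekindDomain.ramificationIdx_eq_normalizedFactors_count (Ideal.span {(2 : ℤ)}) P hne, hmap,
    normalizedFactors_pow, Multiset.count_nsmul]
  exact even_two_mul _

/-! ### The prime of `K` above `2` with odd `e` ramifies in `L`, with a unique prime above it -/

/-- **`e(𝔭, L/K) = 2` for a prime `𝔭 ∣ 2` of `K` with `e(𝔭 | 2ℤ)` odd** (`[L : K] = 2`, `L/K` Galois, `x ∈ 𝓞_L`, `x² = −1`): for a
prime `𝔓` of `L` over `𝔭`, `e(𝔓 | 2ℤ) = e(𝔭 | 2ℤ) · e(𝔓 | 𝔭)` is even, so `e(𝔓 | 𝔭)` is even, and `e(𝔓 | 𝔭) ∣ [L : K] = 2`.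
[cite: NeukirchANT1999, Ch. I §8 Prop. (8.2)] [cite: Marcus2018, Ch. 4 (e and f are multiplicative in towers)] -/
theorem ramificationIdxIn_eq_two_of_odd_ramificationIdx [IsGalois K L] (h2 : Module.finrank K L = 2) {x : 𝓞 L}
    (hx : x ^ 2 = -1) (p : Ideal (𝓞 K)) [p.IsPrime] [p.LiesOver (Ideal.span {(2 : ℤ)})]
    (hodd : Odd (p.ramificationIdx ℤ)) :
    p.ramificationIdxIn (𝓞 L) = 2 ∧ (p.primesOver (𝓞 L)).ncard = 1 := by
  classical
  have h2ne : (Ideal.span {(2 : ℤ)} : Ideal ℤ) ≠ ⊥ := by rw [Ne, Ideal.span_singleton_eq_bot]; norm_num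
  have hp0 : p ≠ ⊥ := Ideal.ne_bot_of_liesOver_of_ne_bot h2ne p
  haveI := (inferInstance : p.IsPrime).isMaximal hp0
  obtain ⟨P, hPmax, hPover⟩ := Ideal.exists_maximal_ideal_liesOver_of_isIntegral (S := 𝓞 L) p
  haveI := hPmax
  haveI := hPover
  haveI : P.LiesOver (Ideal.span {(2 : ℤ)}) := Ideal.LiesOver.trans P p _
  -- `e(𝔓 | 2ℤ) = e(𝔭 | 2ℤ) · e(𝔓 | 𝔭)` is even
  have hP2 : P.under (𝓞 K) = p := (Ideal.over_def P p).symm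
  have htower : P.ramificationIdx ℤ = p.ramificationIdx ℤ * P.ramificationIdx (𝓞 K) := by
    have h := Ideal.ramificationIdx_tower (P.under (𝓞 K)) P (R := ℤ)
    rwa [hP2] at h
  have heven := even_ramificationIdx_int_of_sq_eq_neg_one hx P
  rw [htower] at heven
  have hePeven : Even (P.ramificationIdx (𝓞 K)) := by
    rcases Nat.even_mul.mp heven with h | h
    · exact absurd h (Nat.not_even_iff_odd.mpr hodd)
    · exact h
  -- the fundamental identity `g · (e · f) = 2`
  have hfund := Ideal.ncard_primesOver_mul_ramificationIdxIn_mul_inertiaDegIn p (𝓞 L) (L ≃ₐ[K] L)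
  rw [IsGalois.card_aut_eq_finrank, h2, Ideal.ramificationIdxIn_eq_ramificationIdx p P (L ≃ₐ[K] L)] at hfund
  have hepos : 0 < P.ramificationIdx (𝓞 K) := P.ramificationIdx_pos (𝓞 K)
  have hedvd : P.ramificationIdx (𝓞 K) ∣ 2 :=
    ⟨(p.primesOver (𝓞 L)).ncard * p.inertiaDegIn (𝓞 L), by rw [← hfund]; ring⟩
  have he2 : P.ramificationIdx (𝓞 K) = 2 := by
    rcases (Nat.dvd_prime Nat.prime_two).mp hedvd with h | h
    · rw [h] at hePeven; exact absurd hePeven (by decide)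
    · exact h
  refine ⟨by rw [Ideal.ramificationIdxIn_eq_ramificationIdx p P (L ≃ₐ[K] L), he2], ?_⟩
  rw [he2] at hfund
  have hgf : (p.primesOver (𝓞 L)).ncard * p.inertiaDegIn (𝓞 L) = 1 := by linarith
  exact Nat.eq_one_of_mul_eq_one_right hgf

/-! ### Odd primes are unramified -/

/-- **A prime `v ∌ 2` of `K` is unramified in `L = K(x)`, `x² = −1`** (`e(v, L/K) = 1`): every prime of `L` over `v` misses
`4 · (−1)`, hence does not divide the different (tree `isUnramifiedAt_of_sq_eq`). [cite: NeukirchANT1999, Ch. III Thm. (2.6)] -/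
theorem ramificationIdxIn_eq_one_of_two_not_mem [IsGalois K L] {x : 𝓞 L} (hx : x ^ 2 = -1)
    (hgen : Algebra.adjoin K {(x : L)} = ⊤) (v : HeightOneSpectrum (𝓞 K)) (hv : (2 : 𝓞 K) ∉ v.asIdeal) :
    v.asIdeal.ramificationIdxIn (𝓞 L) = 1 := by
  haveI := v.isMaximal
  obtain ⟨Q, hQmax, hQover⟩ := Ideal.exists_maximal_ideal_liesOver_of_isIntegral (S := 𝓞 L) v.asIdeal
  haveI := hQmax
  haveI := hQover
  rw [Ideal.ramificationIdxIn_eq_ramificationIdx v.asIdeal Q (L ≃ₐ[K] L)]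
  have hx' : x ^ 2 = algebraMap (𝓞 K) (𝓞 L) (-1) := by rw [hx, map_neg, map_one]
  have hunr : Algebra.IsUnramifiedAt (𝓞 K) Q := by
    refine isUnramifiedAt_of_sq_eq hx' hgen Q fun hmem => hv ?_
    have h4 : algebraMap (𝓞 K) (𝓞 L) (4 * (-1)) = -(2 * 2) := by rw [map_mul, map_neg, map_one, map_ofNat]; norm_num
    rw [h4, Ideal.neg_mem_iff] at hmem
    have h2Q : (2 : 𝓞 L) ∈ Q := ((inferInstance : Q.IsPrime).mem_or_mem hmem).elim id id
    have h2u : (2 : 𝓞 K) ∈ Q.under (𝓞 K) := by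
      rw [Ideal.under_def, Ideal.mem_comap, map_ofNat]; exact h2Q
    rwa [← Ideal.over_def Q v.asIdeal] at h2u
  exact Ideal.ramificationIdx_eq_one_iff.mpr hunr

/-! ### Assembly: one prime above `2` in `L`, and `∏ e = 2` -/

omit [NumberField K] in
/-- A non-zero prime of `𝓞_K` containing `2` lies over `2ℤ`. [folklore] -/
private theorem liesOver_span_two {p : Ideal (𝓞 K)} [p.IsPrime] (h2 : (2 : 𝓞 K) ∈ p) :
    p.LiesOver (Ideal.span {(2 : ℤ)}) := by
  refine ⟨?_⟩
  have hmax : (Ideal.span {(2 : ℤ)}).IsMaximal :=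
    PrincipalIdealRing.isMaximal_of_irreducible (Int.prime_two.irreducible)
  have hle : Ideal.span {(2 : ℤ)} ≤ p.under ℤ := by
    rw [Ideal.span_le, Set.singleton_subset_iff]
    change algebraMap ℤ (𝓞 K) 2 ∈ p
    rwa [map_ofNat]
  exact (hmax.eq_of_le (Ideal.IsPrime.ne_top inferInstance) hle)

/-- **Exactly one prime of `L` above `2`**, when `K` has exactly one prime above `2`, with odd `e` over `2`, and `x² = −1` in `𝓞_L`
(`[L:K] = 2`, Galois): every prime of `L` above `2` lies over THE prime `𝔭` of `K`, over which there is exactly one prime.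
[cite: NeukirchANT1999, Ch. I §8 Prop. (8.2)] -/
theorem existsUnique_two_mem_of_sq_eq_neg_one [IsGalois K L] (h2 : Module.finrank K L = 2) {x : 𝓞 L} (hx : x ^ 2 = -1)
    (hK : ∃! v : HeightOneSpectrum (𝓞 K), ((2 : ℕ) : 𝓞 K) ∈ v.asIdeal)
    (hodd : ∀ v : HeightOneSpectrum (𝓞 K), ((2 : ℕ) : 𝓞 K) ∈ v.asIdeal → Odd (v.asIdeal.ramificationIdx ℤ)) :
    ∃! w : HeightOneSpectrum (𝓞 L), ((2 : ℕ) : 𝓞 L) ∈ w.asIdeal := by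
  classical
  obtain ⟨v₀, hv₀, huniq⟩ := hK
  have hv₀' : (2 : 𝓞 K) ∈ v₀.asIdeal := by exact_mod_cast hv₀
  haveI : v₀.asIdeal.LiesOver (Ideal.span {(2 : ℤ)}) := liesOver_span_two hv₀'
  obtain ⟨-, hone⟩ := ramificationIdxIn_eq_two_of_odd_ramificationIdx h2 hx v₀.asIdeal (hodd v₀ hv₀)
  obtain ⟨P, hP⟩ := Set.ncard_eq_one.mp hone
  have hPmem : P ∈ v₀.asIdeal.primesOver (𝓞 L) := by rw [hP]; exact Set.mem_singleton P
  obtain ⟨hPprime, hPover⟩ := hPmem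
  have hP0 : P ≠ ⊥ := Ideal.ne_bot_of_liesOver_of_ne_bot v₀.ne_bot P
  have h2P : (2 : 𝓞 L) ∈ P := by
    have : algebraMap (𝓞 K) (𝓞 L) 2 ∈ P := by
      rw [← Ideal.mem_comap, ← Ideal.under_def, ← Ideal.over_def P v₀.asIdeal]; exact hv₀'
    rwa [map_ofNat] at this
  refine ⟨⟨P, hPprime, hP0⟩, by exact_mod_cast h2P, fun w hw => ?_⟩
  -- `w ∩ 𝓞_K` is a prime above `2`, hence `v₀`; so `w` lies over `v₀` and equals `P`
  have hw' : (2 : 𝓞 L) ∈ w.asIdeal := by exact_mod_cast hw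
  have hu0 : w.asIdeal.under (𝓞 K) ≠ ⊥ := fun h =>
    w.ne_bot (Ideal.eq_bot_of_comap_eq_bot (R := 𝓞 K) h)
  let u : HeightOneSpectrum (𝓞 K) := ⟨w.asIdeal.under (𝓞 K), Ideal.IsPrime.under (𝓞 K) w.asIdeal, hu0⟩
  have hu2 : ((2 : ℕ) : 𝓞 K) ∈ u.asIdeal := by
    change ((2 : ℕ) : 𝓞 K) ∈ w.asIdeal.under (𝓞 K)
    rw [Ideal.under_def, Ideal.mem_comap, Nat.cast_ofNat, map_ofNat]; exact hw'
  have huv : u = v₀ := huniq u hu2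
  have hwover : w.asIdeal.LiesOver v₀.asIdeal := ⟨by rw [← huv]⟩
  have hwmem : w.asIdeal ∈ v₀.asIdeal.primesOver (𝓞 L) := ⟨w.isPrime, hwover⟩
  rw [hP, Set.mem_singleton_iff] at hwmem
  exact HeightOneSpectrum.ext hwmem

/-- **`∏_𝔮 e_𝔮(L/K) = 2`** for `L = K(x)`, `x² = −1`, `[L:K] = 2` Galois, when `K` has exactly one prime `𝔭` above `2` and
`e(𝔭 | 2ℤ)` is odd: the ramified finite primes of `L/K` are exactly `{𝔭}` (`𝔭` ramifies with `e = 2`; primes `∌ 2` are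
unramified), and `∏ e = 2^{#ramified}` in a quadratic extension. [cite: NeukirchANT1999, Ch. I §8 (8.2) and Ch. III (2.6)]
[cite: Lang1990, Ch. 13 §4, proof of Lemma 4.2 (PDF p. 204)] -/
theorem finprod_ramificationIdxIn_eq_two_of_sq_eq_neg_one [IsGalois K L] (h2 : Module.finrank K L = 2) {x : 𝓞 L}
    (hx : x ^ 2 = -1) (hgen : Algebra.adjoin K {(x : L)} = ⊤)
    (hK : ∃! v : HeightOneSpectrum (𝓞 K), ((2 : ℕ) : 𝓞 K) ∈ v.asIdeal)
    (hodd : ∀ v : HeightOneSpectrum (𝓞 K), ((2 : ℕ) : 𝓞 K) ∈ v.asIdeal → Odd (v.asIdeal.ramificationIdx ℤ)) :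
    (∏ᶠ v : HeightOneSpectrum (𝓞 K), v.asIdeal.ramificationIdxIn (𝓞 L)) = 2 := by
  classical
  obtain ⟨v₀, hv₀, huniq⟩ := hK
  have hv₀' : (2 : 𝓞 K) ∈ v₀.asIdeal := by exact_mod_cast hv₀
  haveI : v₀.asIdeal.LiesOver (Ideal.span {(2 : ℤ)}) := liesOver_span_two hv₀'
  obtain ⟨he2, -⟩ := ramificationIdxIn_eq_two_of_odd_ramificationIdx h2 hx v₀.asIdeal (hodd v₀ hv₀)
  rw [AmbiguousClass.finprod_ramificationIdxIn_eq_pow_of_prime Nat.prime_two h2]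
  have hset : {v : HeightOneSpectrum (𝓞 K) | v.asIdeal.ramificationIdxIn (𝓞 L) ≠ 1} = {v₀} := by
    ext v
    simp only [Set.mem_setOf_eq, Set.mem_singleton_iff]
    constructor
    · intro hv
      by_contra hne
      apply hv
      refine ramificationIdxIn_eq_one_of_two_not_mem hx hgen v fun h2v => hne (huniq v ?_)
      exact_mod_cast h2v
    · rintro rfl
      rw [he2]; decide
  rw [hset, Set.ncard_singleton, pow_one]

end Literature.NumberTheory.NumberFields

end
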